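import Mathlib
import Summits.CriticalPhenomena.CardyFormulaZ2.Theorems.CardyFlipRussoSquareFromVoronoiHubDefs
import Literature.Probability.RandomPlanarGeometry.PlanarDomainsTopology

/-!
# Stub `stub_faithful` (K1), line `Sketch` of crux `SquareFromVoronoiHub` — Part 5:
# first entry through `(ab)` — robustly black paths started in an exterior cap

Crux `Summit.CriticalPhenomena.CardyFormulaZ2.Theses.CardyFlipRusso.SquareFromVoronoiHub`
(stmt-CriticalPhenomena-6434), line `Sketch` (card `voronoi-blocks-on-fixed-gs`), stub
`stub_faithful` (K1); registered sub-goal `stub_faithful_part5`.  Purely topological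
boundary-layer lemma preparing (with Parts 2 and 4; assembled in Part 6) the design of the lower
sandwich rectangle `R₁` of Part 3
(exterior caps beyond `(ab)`, `(cd)` with the marked points `a₁, b₁, c₁, d₁` on the outer cap
boundaries AWAY from `closure Ω`, so that every continuum crossing of `R₁`, and the skeleton path
through the in-discs and shared-edge midpoints of its black cells, STARTS deep in the exterior cap
beyond `(ab)`):

* `exists_first_entry` (purely topological): a path started off `closure Ω` in the `(ab)`-side
  piece `F₀` of a splitting (`F₀`, `F₂` disjoint closed sets containing the off-`closure Ω` points
  of the path, `F₀` far from `(cd)`), staying away from `(bc)`, `(da)`, and coming close to `(cd)`,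
  first meets `closure Ω` at a point of the arc `(ab)`, before any close approach of `(cd)`, having
  stayed in `F₀` off `closure Ω` until then;
* (Part 6) hence Part 2's robust-path lemma applies to the path truncated at its first entry, its
  `hcl` supplied by Part 4's `exists_mem_closure_of_split`: robustly black paths started deep in
  the exterior cap give the crude block crossing, for EVERY conformal rectangle.
-/

noncomputable section

namespace Summit.CriticalPhenomena.CardyFormulaZ2.Cruxes.SquareFromVoronoiHub.VoronoiBlocks.Faithful

open scoped Pointwise Topology
open Set Metric Filter
open Literature.Probability.Percolation (SiteConfig blackRegion)
open Literature.Probability.RandomPlanarGeometry (ConformalRectangle)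
open Literature.Analysis.FunctionSpaces (PointConfig)

/-! ### First entry through `(ab)` -/

/-- **First entry through `(ab)`.**  Let `F₀`, `F₂` be disjoint closed sets containing every point
of the path `γ` off `closure Ω`, with `F₀` at distance `> M` from `(cd) = R.arc 2`; let `γ` start
off `closure Ω` inside `F₀`, stay at distance `> M` from `(bc)`, `(da)`, and come within `M` of
`(cd)`.  Then there is a first time `t₀ ∈ (0, 1]` at which `γ` meets `closure Ω`; there `γ` is ON
the arc `(ab)`; before `t₀` the path is off `closure Ω` and inside `F₀`; and every `M`-approach
of `(cd)` happens at or after `t₀`.  (Connectedness: off `closure Ω` the path cannot jump from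
`F₀` to `F₂`; the entry point is a frontier point in `F₀`, hence on no arc but `(ab)`.) [folklore] -/
theorem exists_first_entry (R : ConformalRectangle) {M : ℝ} (hM : 0 < M) {x y : ℂ} (γ : Path x y)
    {F₀ F₂ : Set ℂ} (hF₀ : IsClosed F₀) (hF₂ : IsClosed F₂) (hdisj : Disjoint F₀ F₂)
    (hout : ∀ t, γ t ∉ closure R.carrier → γ t ∈ F₀ ∪ F₂)
    (h₀ : ∀ z ∈ F₀, M < infDist z (R.arc 2))
    (h1 : ∀ t, M < infDist (γ t) (R.arc 1)) (h3 : ∀ t, M < infDist (γ t) (R.arc 3))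
    (hx : x ∉ closure R.carrier) (hxF : x ∈ F₀) (hy : ∃ t, infDist (γ t) (R.arc 2) ≤ M) :
    ∃ t₀ : ℝ, 0 < t₀ ∧ t₀ ≤ 1 ∧ γ.extend t₀ ∈ R.arc 0 ∧
      (∀ t ∈ Ico 0 t₀, γ.extend t ∉ closure R.carrier ∧ γ.extend t ∈ F₀) ∧
      ∀ t ∈ Icc (0 : ℝ) 1, infDist (γ.extend t) (R.arc 2) ≤ M → t₀ ≤ t := by
  have hcont : Continuous γ.extend := γ.continuous_extend
  -- off `closure Ω`, an initial segment of the path stays inside `F₀`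
  have key : ∀ τ : ℝ, τ ≤ 1 → (∀ t ∈ Ico 0 τ, γ.extend t ∉ closure R.carrier) →
      ∀ t ∈ Ico 0 τ, γ.extend t ∈ F₀ := by
    intro τ hτ1 hτ t ht
    have hsub : γ.extend '' Ico 0 τ ⊆ F₀ ∪ F₂ := by
      rintro _ ⟨u, hu, rfl⟩
      have hu01 : u ∈ Icc (0 : ℝ) 1 := ⟨hu.1, hu.2.le.trans hτ1⟩
      rw [Path.extend_apply γ hu01]
      exact hout _ (by rw [← Path.extend_apply γ hu01]; exact hτ u hu)
    have hpre : IsPreconnected (γ.extend '' Ico 0 τ) := isPreconnected_Ico.image _ hcont.continuousOn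
    have hempty : γ.extend '' Ico 0 τ ∩ (F₀ ∩ F₂) = ∅ := by rw [hdisj.inter_eq, inter_empty]
    have h0mem : (0 : ℝ) ∈ Ico 0 τ := ⟨le_rfl, ht.1.trans_lt ht.2⟩
    rcases (isPreconnected_iff_subset_of_disjoint_closed.1 hpre) F₀ F₂ hF₀ hF₂ hsub hempty with h | h
    · exact h ⟨t, ht, rfl⟩
    · exfalso
      have hx2 : x ∈ F₂ := by simpa [γ.extend_zero] using h ⟨0, h0mem, rfl⟩
      exact Set.disjoint_left.1 hdisj hxF hx2
  -- the (closed, nonempty) set of times in `closure Ω`, and its infimum `t₀`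
  set Scl : Set ℝ := Icc 0 1 ∩ γ.extend ⁻¹' closure R.carrier with hScl
  have hSclc : IsClosed Scl := isClosed_Icc.inter (isClosed_closure.preimage hcont)
  obtain ⟨t₂, ht₂⟩ := hy
  have hSclne : Scl.Nonempty := by
    by_contra hne
    rw [Set.not_nonempty_iff_eq_empty] at hne
    have hall : ∀ t ∈ Ico (0 : ℝ) 1, γ.extend t ∉ closure R.carrier := fun t ht h =>
      (Set.eq_empty_iff_forall_notMem.1 hne) t ⟨⟨ht.1, ht.2.le⟩, h⟩
    -- then the whole path is in `F₀` (by closedness also at time `1`), contradicting `hy`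
    have hF : ∀ t ∈ Icc (0 : ℝ) 1, γ.extend t ∈ F₀ := by
      intro t ht
      rcases ht.2.lt_or_eq with hlt | heq
      · exact key 1 le_rfl hall t ⟨ht.1, hlt⟩
      · subst heq
        have hT : Tendsto γ.extend (𝓝[<] (1 : ℝ)) (𝓝 (γ.extend 1)) :=
          (hcont.tendsto 1).mono_left nhdsWithin_le_nhds
        refine hF₀.mem_of_tendsto hT ?_
        filter_upwards [Ioo_mem_nhdsLT (zero_lt_one' ℝ)] with u hu
        exact key 1 le_rfl hall u ⟨hu.1.le, hu.2⟩
    have := h₀ _ (hF t₂ t₂.2)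
    rw [Path.extend_extends'] at this
    exact this.not_ge ht₂
  have hSclbdd : BddBelow Scl := ⟨0, fun t ht => ht.1.1⟩
  set t₀ := sInf Scl with ht₀
  have ht₀S : t₀ ∈ Scl := hSclc.csInf_mem hSclne hSclbdd
  have ht₀1 : t₀ ≤ 1 := ht₀S.1.2
  have hbefore : ∀ t ∈ Ico 0 t₀, γ.extend t ∉ closure R.carrier := by
    intro t ht h
    have : t ∈ Scl := ⟨⟨ht.1, ht.2.le.trans ht₀1⟩, h⟩
    exact (csInf_le hSclbdd this).not_gt ht.2
  have ht₀0 : 0 < t₀ := by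
    rcases ht₀S.1.1.lt_or_eq with h | h
    · exact h
    · exfalso
      have : γ.extend t₀ ∈ closure R.carrier := ht₀S.2
      rw [← h, γ.extend_zero] at this
      exact hx this
  have hF₀before : ∀ t ∈ Ico 0 t₀, γ.extend t ∈ F₀ := key t₀ ht₀1 hbefore
  -- the entry point is in `F₀` (closedness) and on the frontier, hence on `(ab)`
  have hT₀ : Tendsto γ.extend (𝓝[<] t₀) (𝓝 (γ.extend t₀)) :=
    (hcont.tendsto t₀).mono_left nhdsWithin_le_nhds
  have hmemF₀ : γ.extend t₀ ∈ F₀ := by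
    refine hF₀.mem_of_tendsto hT₀ ?_
    filter_upwards [Ioo_mem_nhdsLT ht₀0] with u hu
    exact hF₀before u ⟨hu.1.le, hu.2⟩
  have hfr : γ.extend t₀ ∈ frontier R.carrier := by
    have hcl : γ.extend t₀ ∈ closure R.carrier := ht₀S.2
    rw [closure_eq_self_union_frontier] at hcl
    rcases hcl with hΩ | hfr
    · exfalso
      have hev : ∀ᶠ u in 𝓝[<] t₀, γ.extend u ∈ R.carrier := hT₀ (R.isOpen.mem_nhds hΩ)
      have hev' : ∀ᶠ u in 𝓝[<] t₀, u ∈ Ioo 0 t₀ := Ioo_mem_nhdsLT ht₀0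
      obtain ⟨u, hu, hu'⟩ := (hev.and hev').exists
      exact hbefore u ⟨hu'.1.le, hu'.2⟩ (subset_closure hu)
    · exact hfr
  have harc : γ.extend t₀ ∈ R.arc 0 := by
    have hU : ⋃ i, R.arc i = frontier R.carrier := R.iUnion_arc_holds
    rw [← hU, mem_iUnion] at hfr
    obtain ⟨i, hi⟩ := hfr
    have ht₀01 : t₀ ∈ Icc (0 : ℝ) 1 := ⟨ht₀0.le, ht₀1⟩
    fin_cases i
    · exact hi
    · exfalso
      have hi' : γ.extend t₀ ∈ R.arc 1 := hi
      have := h1 ⟨t₀, ht₀01⟩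
      rw [← Path.extend_apply γ ht₀01, infDist_zero_of_mem hi'] at this
      exact this.not_ge hM.le
    · exfalso
      have hi' : γ.extend t₀ ∈ R.arc 2 := hi
      have := h₀ _ hmemF₀
      rw [infDist_zero_of_mem hi'] at this
      exact this.not_ge hM.le
    · exfalso
      have hi' : γ.extend t₀ ∈ R.arc 3 := hi
      have := h3 ⟨t₀, ht₀01⟩
      rw [← Path.extend_apply γ ht₀01, infDist_zero_of_mem hi'] at this
      exact this.not_ge hM.le
  refine ⟨t₀, ht₀0, ht₀1, harc, fun t ht => ⟨hbefore t ht, hF₀before t ht⟩, fun t ht htM => ?_⟩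
  refine not_lt.1 fun hlt => ?_
  exact (h₀ _ (hF₀before t ⟨ht.1, hlt⟩)).not_ge htM

/-- **Registered sub-goal `stub_faithful_part5`** of `stub_faithful` (K1): first entry through
`(ab)` of a path started off `closure Ω` in the `(ab)`-side piece of a splitting. [folklore] -/
theorem stub_faithful_part5 : ∀ (R : ConformalRectangle) {M : ℝ}, 0 < M → ∀ {x y : ℂ} (γ : Path x y) {F₀ F₂ : Set ℂ}, IsClosed F₀ → IsClosed F₂ → Disjoint F₀ F₂ → (∀ t, γ t ∉ closure R.carrier → γ t ∈ F₀ ∪ F₂) → (∀ z ∈ F₀, M < Metric.infDist z (R.arc 2)) → (∀ t, M < Metric.infDist (γ t) (R.arc 1)) → (∀ t, M < Metric.infDist (γ t) (R.arc 3)) → x ∉ closure R.carrier → x ∈ F₀ → (∃ t, Metric.infDist (γ t) (R.arc 2) ≤ M) → ∃ t₀ : ℝ, 0 < t₀ ∧ t₀ ≤ 1 ∧ γ.extend t₀ ∈ R.arc 0 ∧ (∀ t ∈ Set.Ico 0 t₀, γ.extend t ∉ closure R.carrier ∧ γ.extend t ∈ F₀) ∧ ∀ t ∈ Set.Icc (0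 : ℝ) 1, Metric.infDist (γ.extend t) (R.arc 2) ≤ M → t₀ ≤ t :=
  fun R _ hM _ _ γ _ _ hF₀ hF₂ hdisj hout h₀ h1 h3 hx hxF hy =>
    exists_first_entry R hM γ hF₀ hF₂ hdisj hout h₀ h1 h3 hx hxF hy

end Summit.CriticalPhenomena.CardyFormulaZ2.Cruxes.SquareFromVoronoiHub.VoronoiBlocks.Faithful

end
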